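import Summits.BirchSwinnertonDyer.BirchSwinnertonDyer.Theorems.KolyvaginDepthDoorDepthTableRowKit
import Summits.BirchSwinnertonDyer.BirchSwinnertonDyer.Theorems.KolyvaginDepthDoorDepthTableGlobalMinimal
import Summits.BirchSwinnertonDyer.BirchSwinnertonDyer.Theorems.Rank2ObservatoryKernelCerts001
import Summits.BirchSwinnertonDyer.Rank1Residual.Additive.PointCountEulerNat
import Literature.NumberTheory.EllipticCurves.BurungaleSkinner2023.Curve14a1TwistsCertificate
import HarnessLib

/-!
# Route `KolyvaginDepthDoor` — DEPTH-TABLE rows 1/6 (`389a1`, `433a1`, `446d1`) with CONCRETE admissible data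
# `(p, d_K, ℓ)`, every side condition decided in the kernel (crux `KolyvaginDepthSupply`, stmt-BirchSwinnertonDyer-21765)

Helper file (`--supports stmt-BirchSwinnertonDyer-21765 --as helper`); it closes nothing. HONEST
FRAMING: per-curve certificate rows of the route's DEPTH TABLE (its cheapest falsifier / instrument,
"the 18 Cremona rank-2 curves `N ≤ 1000`"); each row is CONDITIONAL on exactly two inputs — Kolyvagin
1991 Thm. 4 (`hF`, the route's support item `KolyvaginStructure`, a named Literature fact) and the
COMPUTED bit `c_1(ℓ) ≠ 0` (Jetchev–Lauter–Stein, arXiv:0707.0032 §3.6: `P_ℓ = Σ iσⁱ y_ℓ ∉ pE(K[ℓ])`,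
degree `(ℓ+1) h_K` over `K`) — and BSD is not proved by it. What is NEW over the generic certificate
`depthRow_certificate_of_two_le_rank` (`KolyvaginDepthDoorDepthRow389a1`): the admissible data are
FIXED and ALL their side conditions are theorems of the kernel (kit `KolyvaginDepthDoorDepthTableRowKit`):
`ρ̄_{E,p}` onto (Mazur 6.3 Frobenius witness + Serre 1972 Prop. 21, semistable curves), `p` good
ordinary, `N_E` (semistable curves), the Heegner hypothesis for `(N_E, d_K)`, `ℓ` a Kolyvagin prime
with `M(ℓ) ≥ 1`, `2 ≤ rank_ℤ E(ℚ)` (tree kernel certificates `Rank2Observatory.KernelCerts*`), global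
minimality (`KolyvaginDepthDoorDepthTableGlobalMinimal`). So each row names the EXACT computation the
depth-table seat must run, and its outcome `c_1(ℓ) ≠ 0` certifies `corank_ℤ_p Ш(E)[p^∞] = 0` modulo
`hF` alone. Choice of data: `p` = least prime `≥ 5` of good ordinary reduction with `ρ̄` onto
(`5`, or `7` when `5 ∣ N`); `d_K` = the Heegner discriminant `∉ {−3, −4}`, `p ∤ d_K`, `|d_K| ≤ 120`
minimising the JLS degree `(ℓ+1)·h_K` of its least Kolyvagin prime `ℓ`; `ℓ` = that prime.

| curve | `N` | `Δ` | `p` (`a_p`) | witness `q` (`a_q`) | `d_K` (`h_K`) | `ℓ` (`a_ℓ`) | `ρ̄` onto |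
|---|---|---|---|---|---|---|---|
| `389a1` = `[0, 1, 1, -2, 0]` | `389` | `389` | `5` (`-3`) | `3` (`-2`) | `-7` (`1`) | `19` (`5`) | proved |
| `433a1` = `[1, 0, 0, 0, 1]` | `433` | `-433` | `5` (`-4`) | `3` (`-2`) | `-8` (`1`) | `79` (`10`) | proved |
| `446d1` = `[1, -1, 0, -4, 4]` | `446` | `892` | `5` (`-4`) | `3` (`-3`) | `-23` (`3`) | `19` (`0`) | proved |

Per curve `C<label>`: `intModel`, `card_q` (kernel point counts), `hasSurjectiveModNGaloisRep_p` (or,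
for the curves additive at `2`, only `hasIrreducibleModPGaloisRep_p` and `ρ̄` onto stays a hypothesis),
`goodOrdinary_p`, `conductorNorm_eq` (semistable curves), `heegner_negD`, and the row `depthRow_p_negD_ℓ`.

References: [Kolyvagin1991MathAnn] §2 Thm. 4; [WZhang2014] Thm. 11.2 (i), Notations (xii);
[JetchevLauterStein2009] arXiv:0707.0032 §3.6, Prop. 3.10; [Serre1972] §5.4 Prop. 21; [Mazur1978]
§6 Prop. 6.3 (1); [CremonaAlgorithms1997] Table 1; [GrossLMS1991] §1, §3; [Marcus1977] Ch. 3 Thm. 25.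
-/


set_option linter.dupNamespace false

noncomputable section

open scoped Classical NumberField

namespace Summit.BirchSwinnertonDyer.BirchSwinnertonDyer.Theorems.KolyvaginDepthDoor

open Literature.NumberTheory.EllipticCurves Literature.NumberTheory.EllipticCurves.ModularForms
  WeierstrassCurve
open Summit.BirchSwinnertonDyer.BirchSwinnertonDyer.Rank2Observatory
open Summit.BirchSwinnertonDyer.BirchSwinnertonDyer.Rank1Residual
open Summit.BirchSwinnertonDyer.Rank1Residual.Additive


/-! ## Row `389a1` = `[0,1,1,-2,0]` (`N = 389`, `Δ = 389`): `(p, d_K, ℓ) = (5, -7, 19)` -/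

namespace C389a1

/-- The integral model of `389a1` is `[0, 1, 1, -2, 0]`. [cite: CremonaAlgorithms1997, Table 1 (389a1)] -/
theorem intModel :
    haveI := curve389a1_isGloballyMinimal;
    integralModelInt Curve389a1.E = ⟨0, 1, 1, -2, 0⟩ := by
  haveI := curve389a1_isGloballyMinimal
  exact IntModel.integralModelInt_eq_of_map_eq _ (IntModel.map_mk_int 0 1 1 (-2) 0)

/-- `#Ẽ(𝔽_3) = 6`, `a_3 = -2` (irreducibility witness at `p = 5`) for `389a1`, kernel-decided (`ℕ`-arithmetic Euler
count `PointCountNat.natCard_point_map_eq`). [cite: CremonaAlgorithms1997, Table 1 (389a1)] -/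
theorem card_3 :
    Nat.card (((⟨0, 1, 1, -2, 0⟩ : WeierstrassCurve ℤ).map (Int.castRingHom (ZMod 3))).toAffine.Point) = 6 := by
  rw [PointCountNat.natCard_point_map_eq (hℓ := ⟨by norm_num⟩) (by norm_num) 0 1 1 (-2) 0
    (by decide +kernel)]
  decide +kernel

/-- `#Ẽ(𝔽_5) = 9`, `a_5 = -3` (`p` ordinary) for `389a1`, kernel-decided (`ℕ`-arithmetic Euler
count `PointCountNat.natCard_point_map_eq`). [cite: CremonaAlgorithms1997, Table 1 (389a1)] -/
theorem card_5 :
    Nat.card (((⟨0, 1, 1, -2, 0⟩ : WeierstrassCurve ℤ).map (Int.castRingHom (ZMod 5))).toAffine.Point) = 9 := by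
  rw [PointCountNat.natCard_point_map_eq (hℓ := ⟨by norm_num⟩) (by norm_num) 0 1 1 (-2) 0
    (by decide +kernel)]
  decide +kernel

/-- `#Ẽ(𝔽_19) = 15`, `a_19 = 5` (Kolyvagin prime: `5 ∣ 19 + 1`, `5 ∣ a_19`) for `389a1`, kernel-decided (`ℕ`-arithmetic Euler
count `PointCountNat.natCard_point_map_eq`). [cite: CremonaAlgorithms1997, Table 1 (389a1)] -/
theorem card_19 :
    Nat.card (((⟨0, 1, 1, -2, 0⟩ : WeierstrassCurve ℤ).map (Int.castRingHom (ZMod 19))).toAffine.Point) = 15 := by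
  rw [PointCountNat.natCard_point_map_eq (hℓ := ⟨by norm_num⟩) (by norm_num) 0 1 1 (-2) 0
    (by decide +kernel)]
  decide +kernel

/-- **`ρ̄_{E,5}` is surjective for `E = 389a1`** (unconditional): semistable (`gcd(c₄, Δ) = 1`) and
`X² − a_3X + 3` (`a_3 = -2`) has no root modulo `5` (Mazur's Frobenius certificate ⇒ `E[5]` irreducible;
Serre's Prop. 21 ⇒ onto). [cite: Serre1972, §5.4 Prop. 21] [cite: Mazur1978, §6 Prop. 6.3 (1)] -/
theorem hasSurjectiveModNGaloisRep_5 : Curve389a1.E.HasSurjectiveModNGaloisRep (5 : ℕ) := by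
  have hn : ∀ t : ZMod 5, t ^ 2 - (((3 : ℕ) : ℤ) + 1 - (6 : ℕ) : ℤ) * t + ((3 : ℕ) : ZMod 5) ≠ 0 := by
    decide +kernel
  haveI := Fact.mk (by norm_num : Nat.Prime 5)
  haveI := Fact.mk (by norm_num : Nat.Prime 3)
  haveI := curve389a1_isGloballyMinimal
  exact hasSurjectiveModNGaloisRep_of_intModel_certificate intModel
    (by rw [Int.isCoprime_iff_gcd_eq_one]; decide +kernel) 5 3 (by norm_num) (by decide +kernel)
    (n := 6) card_3 hn

/-- **`5` is a prime of good ordinary reduction for `389a1`** (`5 ∤ Δ`, `a_5 = -3`). [cite: CremonaAlgorithms1997, Table 1 (389a1)] -/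
theorem goodOrdinary_5 :
    haveI := Fact.mk (by norm_num : Nat.Prime 5);
    haveI := curve389a1_isGloballyMinimal;
    Curve389a1.E.HasGoodReductionAtPrime 5 ∧ ¬ ((5 : ℕ) : ℤ) ∣ Curve389a1.E.frobeniusTrace 5 := by
  haveI := Fact.mk (by norm_num : Nat.Prime 5)
  haveI := curve389a1_isGloballyMinimal
  exact goodOrdinary_of_intModel_certificate intModel 5 (by decide +kernel) (n := 9) card_5
    (by decide +kernel)

/-- **`N(389a1) = 389`** (semistable: `gcd(Δ, c₄) = 1`, `N = rad Δ`; Silverman ATAEC IV.10.2). [cite: CremonaAlgorithms1997, Table 1 (389a1)] -/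
theorem conductorNorm_eq : Curve389a1.E.conductorNorm ℤ = 389 := by
  haveI := curve389a1_isGloballyMinimal
  have h : Curve389a1.E = (⟨0, 1, 1, -2, 0⟩ : WeierstrassCurve ℤ).baseChange ℚ :=
    eq_baseChange_of_intModel intModel
  haveI : ((⟨0, 1, 1, -2, 0⟩ : WeierstrassCurve ℤ).baseChange ℚ).IsElliptic := by rw [← h]; infer_instance
  rw [h]
  refine BurungaleSkinner2023.conductorNorm_baseChange_int_of_isCoprime _
    (by rw [Int.isCoprime_iff_gcd_eq_one]; decide +kernel) (k := 1) ?_ (by decide +kernel)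
    (by decide +kernel)
  rw [Nat.squarefree_iff_nodup_primeFactorsList (by norm_num)]; simp

/-- **Heegner data `d_K = -7` for `389a1`**: every prime of `Δ = 389` (hence of `N_E`) splits in a quadratic
field of discriminant `-7` (Kronecker symbols `= 1`). [cite: Marcus1977, Ch. 3 Thm. 25] [cite: GrossLMS1991, §1] -/
theorem heegner_neg7 : ∀ q : ℕ, q.Prime → (q : ℤ) ∣ (⟨0, 1, 1, -2, 0⟩ : WeierstrassCurve ℤ).Δ →
    (q = 2 → (-7 : ℤ) % 8 = 1) ∧ (q ≠ 2 → jacobiSym (-7) q = 1) :=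
  forall_prime_dvd_of_natAbs_eq_pow (a := 389) (i := 1) (by decide +kernel) (by norm_num)
    ⟨by norm_num, by norm_num⟩

/-- **DEPTH-TABLE ROW `389a1`, `(p, d_K, ℓ) = (5, -7, 19)`, modulo Kolyvagin 1991 Thm. 4 (`hF`).** For
`E = 389a1`, ANY imaginary quadratic `K` with `d_K = -7` (`h_K = 1`; such `K` exist, `Rank2Observatory.exists_heegnerField_5077a1`), any modular
parametrisation datum `Dt` of level `N_E`, `β`, `ι : K → ℂ`, and any Kolyvagin–Heegner datum `d` of conductor `19`
(a Kolyvagin prime: inert in `K`, `5 ∣ 20`, `5 ∣ a_19 = 5`): IF `c_1(19) ≠ 0` THEN `corank_ℤ5 Ш(E)[5^∞] = 0`,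
`rank_ℤ E(ℚ) = 2`, `corank Sel_5∞(E/ℚ) = 2` and `corank Sel_5∞(E^(-7)/ℚ) = 1`. Every side condition is PROVED in
the kernel; the inputs left are `hF` and the computed bit.
JLS cost `[K[19] : K] = 20`. BSD is not proved by it.
[cite: Kolyvagin1991MathAnn, §2 Thm. 4] [cite: JetchevLauterStein2009, §3.6 (arXiv:0707.0032)] -/
theorem depthRow_5_neg7_19 (hF : Kolyvagin1991_selmerCorank_of_kolyvaginClass_ne_zero)
    (K : Type) [Field K] [NumberField K] (hK : IsImaginaryQuadratic K)
    (hD : NumberField.discr K = -7) :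
    haveI := curve389a1_isGloballyMinimal;
    haveI := curve389a1_neZero_conductorNorm;
    ∀ (Dt : ModularParametrizationData Curve389a1.E (Curve389a1.E.conductorNorm ℤ)) (β : ℤ)
    (ι : K →+* ℂ) (d : KolyvaginHeegnerData Dt β ι 19),
    d.kolyvaginClass (p := 5) (by norm_num) 1 ≠ 0 →
    Curve389a1.E.shaCorank 5 = 0 ∧ Curve389a1.E.mordellWeilRank = 2 ∧
      Curve389a1.E.selmerCorank 5 = 2 ∧
      (Curve389a1.E.quadraticTwist ((-7 : ℤ) : ℚ)).selmerCorank 5 = 1 := by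
  haveI := curve389a1_isGloballyMinimal
  haveI := curve389a1_neZero_conductorNorm
  intro Dt β ι d hne
  haveI := Fact.mk (by norm_num : Nat.Prime 5)
  exact depthRow_of_intModel_certificate intModel hF Curve389a1.two_le_mordellWeilRank 5 (by norm_num)
    (by decide +kernel) hasSurjectiveModNGaloisRep_5 K hK hD (by norm_num) (by norm_num) (by norm_num) heegner_neg7 19
    (by norm_num) (by norm_num) (by decide +kernel) (by norm_num) (by norm_num) (by norm_num) (by norm_num)
    (n := 15) card_19 (by norm_num) Dt β ι d hne

end C389a1

/-! ## Row `433a1` = `[1,0,0,0,1]` (`N = 433`, `Δ = -433`): `(p, d_K, ℓ) = (5, -8, 79)` -/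

namespace C433a1

/-- The integral model of `433a1` is `[1, 0, 0, 0, 1]`. [cite: CremonaAlgorithms1997, Table 1 (433a1)] -/
theorem intModel :
    haveI := isGloballyMinimal_c433a1;
    integralModelInt ((⟨1, 0, 0, 0, 1⟩ : WeierstrassCurve ℤ).map (Int.castRingHom ℚ)) = ⟨1, 0, 0, 0, 1⟩ := by
  haveI := isGloballyMinimal_c433a1
  exact IntModel.integralModelInt_eq_of_map_eq _ rfl

/-- `#Ẽ(𝔽_3) = 6`, `a_3 = -2` (irreducibility witness at `p = 5`) for `433a1`, kernel-decided (`ℕ`-arithmetic Euler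
count `PointCountNat.natCard_point_map_eq`). [cite: CremonaAlgorithms1997, Table 1 (433a1)] -/
theorem card_3 :
    Nat.card (((⟨1, 0, 0, 0, 1⟩ : WeierstrassCurve ℤ).map (Int.castRingHom (ZMod 3))).toAffine.Point) = 6 := by
  rw [PointCountNat.natCard_point_map_eq (hℓ := ⟨by norm_num⟩) (by norm_num) 1 0 0 0 1
    (by decide +kernel)]
  decide +kernel

/-- `#Ẽ(𝔽_5) = 10`, `a_5 = -4` (`p` ordinary) for `433a1`, kernel-decided (`ℕ`-arithmetic Euler
count `PointCountNat.natCard_point_map_eq`). [cite: CremonaAlgorithms1997, Table 1 (433a1)] -/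
theorem card_5 :
    Nat.card (((⟨1, 0, 0, 0, 1⟩ : WeierstrassCurve ℤ).map (Int.castRingHom (ZMod 5))).toAffine.Point) = 10 := by
  rw [PointCountNat.natCard_point_map_eq (hℓ := ⟨by norm_num⟩) (by norm_num) 1 0 0 0 1
    (by decide +kernel)]
  decide +kernel

/-- `#Ẽ(𝔽_79) = 70`, `a_79 = 10` (Kolyvagin prime: `5 ∣ 79 + 1`, `5 ∣ a_79`) for `433a1`, kernel-decided (`ℕ`-arithmetic Euler
count `PointCountNat.natCard_point_map_eq`). [cite: CremonaAlgorithms1997, Table 1 (433a1)] -/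
theorem card_79 :
    Nat.card (((⟨1, 0, 0, 0, 1⟩ : WeierstrassCurve ℤ).map (Int.castRingHom (ZMod 79))).toAffine.Point) = 70 := by
  rw [PointCountNat.natCard_point_map_eq (hℓ := ⟨by norm_num⟩) (by norm_num) 1 0 0 0 1
    (by decide +kernel)]
  decide +kernel

/-- **`ρ̄_{E,5}` is surjective for `E = 433a1`** (unconditional): semistable (`gcd(c₄, Δ) = 1`) and
`X² − a_3X + 3` (`a_3 = -2`) has no root modulo `5` (Mazur's Frobenius certificate ⇒ `E[5]` irreducible;
Serre's Prop. 21 ⇒ onto). [cite: Serre1972, §5.4 Prop. 21] [cite: Mazur1978, §6 Prop. 6.3 (1)] -/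
theorem hasSurjectiveModNGaloisRep_5 : ((⟨1, 0, 0, 0, 1⟩ : WeierstrassCurve ℤ).map (Int.castRingHom ℚ)).HasSurjectiveModNGaloisRep (5 : ℕ) := by
  have hn : ∀ t : ZMod 5, t ^ 2 - (((3 : ℕ) : ℤ) + 1 - (6 : ℕ) : ℤ) * t + ((3 : ℕ) : ZMod 5) ≠ 0 := by
    decide +kernel
  haveI := Fact.mk (by norm_num : Nat.Prime 5)
  haveI := Fact.mk (by norm_num : Nat.Prime 3)
  haveI := isElliptic_c433a1
  haveI := isGloballyMinimal_c433a1
  exact hasSurjectiveModNGaloisRep_of_intModel_certificate intModel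
    (by rw [Int.isCoprime_iff_gcd_eq_one]; decide +kernel) 5 3 (by norm_num) (by decide +kernel)
    (n := 6) card_3 hn

/-- **`5` is a prime of good ordinary reduction for `433a1`** (`5 ∤ Δ`, `a_5 = -4`). [cite: CremonaAlgorithms1997, Table 1 (433a1)] -/
theorem goodOrdinary_5 :
    haveI := Fact.mk (by norm_num : Nat.Prime 5);
    haveI := isGloballyMinimal_c433a1;
    ((⟨1, 0, 0, 0, 1⟩ : WeierstrassCurve ℤ).map (Int.castRingHom ℚ)).HasGoodReductionAtPrime 5 ∧ ¬ ((5 : ℕ) : ℤ) ∣ ((⟨1, 0, 0, 0, 1⟩ : WeierstrassCurve ℤ).map (Int.castRingHom ℚ)).frobeniusTrace 5 := by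
  haveI := Fact.mk (by norm_num : Nat.Prime 5)
  haveI := isGloballyMinimal_c433a1
  exact goodOrdinary_of_intModel_certificate intModel 5 (by decide +kernel) (n := 10) card_5
    (by decide +kernel)

/-- **`N(433a1) = 433`** (semistable: `gcd(Δ, c₄) = 1`, `N = rad Δ`; Silverman ATAEC IV.10.2). [cite: CremonaAlgorithms1997, Table 1 (433a1)] -/
theorem conductorNorm_eq : ((⟨1, 0, 0, 0, 1⟩ : WeierstrassCurve ℤ).map (Int.castRingHom ℚ)).conductorNorm ℤ = 433 := by
  haveI := isElliptic_c433a1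
  haveI := isGloballyMinimal_c433a1
  have h : ((⟨1, 0, 0, 0, 1⟩ : WeierstrassCurve ℤ).map (Int.castRingHom ℚ)) = (⟨1, 0, 0, 0, 1⟩ : WeierstrassCurve ℤ).baseChange ℚ :=
    eq_baseChange_of_intModel intModel
  haveI : ((⟨1, 0, 0, 0, 1⟩ : WeierstrassCurve ℤ).baseChange ℚ).IsElliptic := by rw [← h]; infer_instance
  rw [h]
  refine BurungaleSkinner2023.conductorNorm_baseChange_int_of_isCoprime _
    (by rw [Int.isCoprime_iff_gcd_eq_one]; decide +kernel) (k := 1) ?_ (by decide +kernel)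
    (by decide +kernel)
  rw [Nat.squarefree_iff_nodup_primeFactorsList (by norm_num)]; simp

/-- **Heegner data `d_K = -8` for `433a1`**: every prime of `Δ = -433` (hence of `N_E`) splits in a quadratic
field of discriminant `-8` (Kronecker symbols `= 1`). [cite: Marcus1977, Ch. 3 Thm. 25] [cite: GrossLMS1991, §1] -/
theorem heegner_neg8 : ∀ q : ℕ, q.Prime → (q : ℤ) ∣ (⟨1, 0, 0, 0, 1⟩ : WeierstrassCurve ℤ).Δ →
    (q = 2 → (-8 : ℤ) % 8 = 1) ∧ (q ≠ 2 → jacobiSym (-8) q = 1) :=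
  forall_prime_dvd_of_natAbs_eq_pow (a := 433) (i := 1) (by decide +kernel) (by norm_num)
    ⟨by norm_num, by norm_num⟩

/-- **DEPTH-TABLE ROW `433a1`, `(p, d_K, ℓ) = (5, -8, 79)`, modulo Kolyvagin 1991 Thm. 4 (`hF`).** For
`E = 433a1`, ANY imaginary quadratic `K` with `d_K = -8` (`h_K = 1`; such `K` exist, `exists_field_neg8`), any modular
parametrisation datum `Dt` of level `N_E`, `β`, `ι : K → ℂ`, and any Kolyvagin–Heegner datum `d` of conductor `79`
(a Kolyvagin prime: inert in `K`, `5 ∣ 80`, `5 ∣ a_79 = 10`): IF `c_1(79) ≠ 0` THEN `corank_ℤ5 Ш(E)[5^∞] = 0`,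
`rank_ℤ E(ℚ) = 2`, `corank Sel_5∞(E/ℚ) = 2` and `corank Sel_5∞(E^(-8)/ℚ) = 1`. Every side condition is PROVED in
the kernel; the inputs left are `hF` and the computed bit.
JLS cost `[K[79] : K] = 80`. BSD is not proved by it.
[cite: Kolyvagin1991MathAnn, §2 Thm. 4] [cite: JetchevLauterStein2009, §3.6 (arXiv:0707.0032)] -/
theorem depthRow_5_neg8_79 (hF : Kolyvagin1991_selmerCorank_of_kolyvaginClass_ne_zero)
    (K : Type) [Field K] [NumberField K] (hK : IsImaginaryQuadratic K)
    (hD : NumberField.discr K = -8) :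
    haveI := isElliptic_c433a1;
    haveI := isGloballyMinimal_c433a1;
    haveI : NeZero (((⟨1, 0, 0, 0, 1⟩ : WeierstrassCurve ℤ).map (Int.castRingHom ℚ)).conductorNorm ℤ) := neZero_conductorNorm_of_isElliptic _;
    ∀ (Dt : ModularParametrizationData ((⟨1, 0, 0, 0, 1⟩ : WeierstrassCurve ℤ).map (Int.castRingHom ℚ)) (((⟨1, 0, 0, 0, 1⟩ : WeierstrassCurve ℤ).map (Int.castRingHom ℚ)).conductorNorm ℤ)) (β : ℤ)
    (ι : K →+* ℂ) (d : KolyvaginHeegnerData Dt β ι 79),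
    d.kolyvaginClass (p := 5) (by norm_num) 1 ≠ 0 →
    ((⟨1, 0, 0, 0, 1⟩ : WeierstrassCurve ℤ).map (Int.castRingHom ℚ)).shaCorank 5 = 0 ∧ ((⟨1, 0, 0, 0, 1⟩ : WeierstrassCurve ℤ).map (Int.castRingHom ℚ)).mordellWeilRank = 2 ∧
      ((⟨1, 0, 0, 0, 1⟩ : WeierstrassCurve ℤ).map (Int.castRingHom ℚ)).selmerCorank 5 = 2 ∧
      (((⟨1, 0, 0, 0, 1⟩ : WeierstrassCurve ℤ).map (Int.castRingHom ℚ)).quadraticTwist ((-8 : ℤ) : ℚ)).selmerCorank 5 = 1 := by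
  haveI := isElliptic_c433a1
  haveI := isGloballyMinimal_c433a1
  haveI : NeZero (((⟨1, 0, 0, 0, 1⟩ : WeierstrassCurve ℤ).map (Int.castRingHom ℚ)).conductorNorm ℤ) := neZero_conductorNorm_of_isElliptic _
  intro Dt β ι d hne
  haveI := Fact.mk (by norm_num : Nat.Prime 5)
  exact depthRow_of_intModel_certificate intModel hF KernelCerts001.C433a1.two_le_rank 5 (by norm_num)
    (by decide +kernel) hasSurjectiveModNGaloisRep_5 K hK hD (by norm_num) (by norm_num) (by norm_num) heegner_neg8 79
    (by norm_num) (by norm_num) (by decide +kernel) (by norm_num) (by norm_num) (by norm_num) (by norm_num)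
    (n := 70) card_79 (by norm_num) Dt β ι d hne

end C433a1

/-! ## Row `446d1` = `[1,-1,0,-4,4]` (`N = 446`, `Δ = 892`): `(p, d_K, ℓ) = (5, -23, 19)` -/

namespace C446d1

/-- The integral model of `446d1` is `[1, -1, 0, -4, 4]`. [cite: CremonaAlgorithms1997, Table 1 (446d1)] -/
theorem intModel :
    haveI := isGloballyMinimal_c446d1;
    integralModelInt ((⟨1, -1, 0, -4, 4⟩ : WeierstrassCurve ℤ).map (Int.castRingHom ℚ)) = ⟨1, -1, 0, -4, 4⟩ := by
  haveI := isGloballyMinimal_c446d1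
  exact IntModel.integralModelInt_eq_of_map_eq _ rfl

/-- `#Ẽ(𝔽_3) = 7`, `a_3 = -3` (irreducibility witness at `p = 5`) for `446d1`, kernel-decided (`ℕ`-arithmetic Euler
count `PointCountNat.natCard_point_map_eq`). [cite: CremonaAlgorithms1997, Table 1 (446d1)] -/
theorem card_3 :
    Nat.card (((⟨1, -1, 0, -4, 4⟩ : WeierstrassCurve ℤ).map (Int.castRingHom (ZMod 3))).toAffine.Point) = 7 := by
  rw [PointCountNat.natCard_point_map_eq (hℓ := ⟨by norm_num⟩) (by norm_num) 1 (-1) 0 (-4) 4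
    (by decide +kernel)]
  decide +kernel

/-- `#Ẽ(𝔽_5) = 10`, `a_5 = -4` (`p` ordinary) for `446d1`, kernel-decided (`ℕ`-arithmetic Euler
count `PointCountNat.natCard_point_map_eq`). [cite: CremonaAlgorithms1997, Table 1 (446d1)] -/
theorem card_5 :
    Nat.card (((⟨1, -1, 0, -4, 4⟩ : WeierstrassCurve ℤ).map (Int.castRingHom (ZMod 5))).toAffine.Point) = 10 := by
  rw [PointCountNat.natCard_point_map_eq (hℓ := ⟨by norm_num⟩) (by norm_num) 1 (-1) 0 (-4) 4
    (by decide +kernel)]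
  decide +kernel

/-- `#Ẽ(𝔽_19) = 20`, `a_19 = 0` (Kolyvagin prime: `5 ∣ 19 + 1`, `5 ∣ a_19`) for `446d1`, kernel-decided (`ℕ`-arithmetic Euler
count `PointCountNat.natCard_point_map_eq`). [cite: CremonaAlgorithms1997, Table 1 (446d1)] -/
theorem card_19 :
    Nat.card (((⟨1, -1, 0, -4, 4⟩ : WeierstrassCurve ℤ).map (Int.castRingHom (ZMod 19))).toAffine.Point) = 20 := by
  rw [PointCountNat.natCard_point_map_eq (hℓ := ⟨by norm_num⟩) (by norm_num) 1 (-1) 0 (-4) 4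
    (by decide +kernel)]
  decide +kernel

/-- **`ρ̄_{E,5}` is surjective for `E = 446d1`** (unconditional): semistable (`gcd(c₄, Δ) = 1`) and
`X² − a_3X + 3` (`a_3 = -3`) has no root modulo `5` (Mazur's Frobenius certificate ⇒ `E[5]` irreducible;
Serre's Prop. 21 ⇒ onto). [cite: Serre1972, §5.4 Prop. 21] [cite: Mazur1978, §6 Prop. 6.3 (1)] -/
theorem hasSurjectiveModNGaloisRep_5 : ((⟨1, -1, 0, -4, 4⟩ : WeierstrassCurve ℤ).map (Int.castRingHom ℚ)).HasSurjectiveModNGaloisRep (5 : ℕ) := by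
  have hn : ∀ t : ZMod 5, t ^ 2 - (((3 : ℕ) : ℤ) + 1 - (7 : ℕ) : ℤ) * t + ((3 : ℕ) : ZMod 5) ≠ 0 := by
    decide +kernel
  haveI := Fact.mk (by norm_num : Nat.Prime 5)
  haveI := Fact.mk (by norm_num : Nat.Prime 3)
  haveI := isElliptic_c446d1
  haveI := isGloballyMinimal_c446d1
  exact hasSurjectiveModNGaloisRep_of_intModel_certificate intModel
    (by rw [Int.isCoprime_iff_gcd_eq_one]; decide +kernel) 5 3 (by norm_num) (by decide +kernel)
    (n := 7) card_3 hn

/-- **`5` is a prime of good ordinary reduction for `446d1`** (`5 ∤ Δ`, `a_5 = -4`). [cite: CremonaAlgorithms1997, Table 1 (446d1)] -/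
theorem goodOrdinary_5 :
    haveI := Fact.mk (by norm_num : Nat.Prime 5);
    haveI := isGloballyMinimal_c446d1;
    ((⟨1, -1, 0, -4, 4⟩ : WeierstrassCurve ℤ).map (Int.castRingHom ℚ)).HasGoodReductionAtPrime 5 ∧ ¬ ((5 : ℕ) : ℤ) ∣ ((⟨1, -1, 0, -4, 4⟩ : WeierstrassCurve ℤ).map (Int.castRingHom ℚ)).frobeniusTrace 5 := by
  haveI := Fact.mk (by norm_num : Nat.Prime 5)
  haveI := isGloballyMinimal_c446d1
  exact goodOrdinary_of_intModel_certificate intModel 5 (by decide +kernel) (n := 10) card_5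
    (by decide +kernel)

/-- **`N(446d1) = 446`** (semistable: `gcd(Δ, c₄) = 1`, `N = rad Δ`; Silverman ATAEC IV.10.2). [cite: CremonaAlgorithms1997, Table 1 (446d1)] -/
theorem conductorNorm_eq : ((⟨1, -1, 0, -4, 4⟩ : WeierstrassCurve ℤ).map (Int.castRingHom ℚ)).conductorNorm ℤ = 446 := by
  haveI := isElliptic_c446d1
  haveI := isGloballyMinimal_c446d1
  have h : ((⟨1, -1, 0, -4, 4⟩ : WeierstrassCurve ℤ).map (Int.castRingHom ℚ)) = (⟨1, -1, 0, -4, 4⟩ : WeierstrassCurve ℤ).baseChange ℚ :=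
    eq_baseChange_of_intModel intModel
  haveI : ((⟨1, -1, 0, -4, 4⟩ : WeierstrassCurve ℤ).baseChange ℚ).IsElliptic := by rw [← h]; infer_instance
  rw [h]
  refine BurungaleSkinner2023.conductorNorm_baseChange_int_of_isCoprime _
    (by rw [Int.isCoprime_iff_gcd_eq_one]; decide +kernel) (k := 2) ?_ (by decide +kernel)
    (by decide +kernel)
  rw [Nat.squarefree_iff_nodup_primeFactorsList (by norm_num)]; simp

/-- **Heegner data `d_K = -23` for `446d1`**: every prime of `Δ = 892` (hence of `N_E`) splits in a quadratic
field of discriminant `-23` (Kronecker symbols `= 1`). [cite: Marcus1977, Ch. 3 Thm. 25] [cite: GrossLMS1991, §1] -/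
theorem heegner_neg23 : ∀ q : ℕ, q.Prime → (q : ℤ) ∣ (⟨1, -1, 0, -4, 4⟩ : WeierstrassCurve ℤ).Δ →
    (q = 2 → (-23 : ℤ) % 8 = 1) ∧ (q ≠ 2 → jacobiSym (-23) q = 1) :=
  forall_prime_dvd_of_natAbs_eq_pow_mul_pow (a := 2) (i := 2) (b := 223) (j := 1) (by decide +kernel)
    (by norm_num) (by norm_num) ⟨by norm_num, by norm_num⟩ ⟨by norm_num, by norm_num⟩

/-- **DEPTH-TABLE ROW `446d1`, `(p, d_K, ℓ) = (5, -23, 19)`, modulo Kolyvagin 1991 Thm. 4 (`hF`).** For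
`E = 446d1`, ANY imaginary quadratic `K` with `d_K = -23` (`h_K = 3`; such `K` exist, `exists_field_neg23`), any modular
parametrisation datum `Dt` of level `N_E`, `β`, `ι : K → ℂ`, and any Kolyvagin–Heegner datum `d` of conductor `19`
(a Kolyvagin prime: inert in `K`, `5 ∣ 20`, `5 ∣ a_19 = 0`): IF `c_1(19) ≠ 0` THEN `corank_ℤ5 Ш(E)[5^∞] = 0`,
`rank_ℤ E(ℚ) = 2`, `corank Sel_5∞(E/ℚ) = 2` and `corank Sel_5∞(E^(-23)/ℚ) = 1`. Every side condition is PROVED in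
the kernel; the inputs left are `hF` and the computed bit.
JLS cost `[K[19] : K] = 60`. BSD is not proved by it.
[cite: Kolyvagin1991MathAnn, §2 Thm. 4] [cite: JetchevLauterStein2009, §3.6 (arXiv:0707.0032)] -/
theorem depthRow_5_neg23_19 (hF : Kolyvagin1991_selmerCorank_of_kolyvaginClass_ne_zero)
    (K : Type) [Field K] [NumberField K] (hK : IsImaginaryQuadratic K)
    (hD : NumberField.discr K = -23) :
    haveI := isElliptic_c446d1;
    haveI := isGloballyMinimal_c446d1;
    haveI : NeZero (((⟨1, -1, 0, -4, 4⟩ : WeierstrassCurve ℤ).map (Int.castRingHom ℚ)).conductorNorm ℤ) := neZero_conductorNorm_of_isElliptic _;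
    ∀ (Dt : ModularParametrizationData ((⟨1, -1, 0, -4, 4⟩ : WeierstrassCurve ℤ).map (Int.castRingHom ℚ)) (((⟨1, -1, 0, -4, 4⟩ : WeierstrassCurve ℤ).map (Int.castRingHom ℚ)).conductorNorm ℤ)) (β : ℤ)
    (ι : K →+* ℂ) (d : KolyvaginHeegnerData Dt β ι 19),
    d.kolyvaginClass (p := 5) (by norm_num) 1 ≠ 0 →
    ((⟨1, -1, 0, -4, 4⟩ : WeierstrassCurve ℤ).map (Int.castRingHom ℚ)).shaCorank 5 = 0 ∧ ((⟨1, -1, 0, -4, 4⟩ : WeierstrassCurve ℤ).map (Int.castRingHom ℚ)).mordellWeilRank = 2 ∧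
      ((⟨1, -1, 0, -4, 4⟩ : WeierstrassCurve ℤ).map (Int.castRingHom ℚ)).selmerCorank 5 = 2 ∧
      (((⟨1, -1, 0, -4, 4⟩ : WeierstrassCurve ℤ).map (Int.castRingHom ℚ)).quadraticTwist ((-23 : ℤ) : ℚ)).selmerCorank 5 = 1 := by
  haveI := isElliptic_c446d1
  haveI := isGloballyMinimal_c446d1
  haveI : NeZero (((⟨1, -1, 0, -4, 4⟩ : WeierstrassCurve ℤ).map (Int.castRingHom ℚ)).conductorNorm ℤ) := neZero_conductorNorm_of_isElliptic _
  intro Dt β ι d hne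
  haveI := Fact.mk (by norm_num : Nat.Prime 5)
  exact depthRow_of_intModel_certificate intModel hF KernelCerts001.C446d1.two_le_rank 5 (by norm_num)
    (by decide +kernel) hasSurjectiveModNGaloisRep_5 K hK hD (by norm_num) (by norm_num) (by norm_num) heegner_neg23 19
    (by norm_num) (by norm_num) (by decide +kernel) (by norm_num) (by norm_num) (by norm_num) (by norm_num)
    (n := 20) card_19 (by norm_num) Dt β ι d hne

end C446d1

end Summit.BirchSwinnertonDyer.BirchSwinnertonDyer.Theorems.KolyvaginDepthDoor

end
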